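import Summits.NavierStokesRegularity.NavierStokesRegularity.Theses.QuasipotentialCoercivity
import Literature.Analysis.FluidPDE.RapidDecayLemmas
import Literature.Analysis.FluidPDE.TaoClassGlue
import HarnessLib

/-!
# Birth skeleton (BC3) — child I `TypeIActionCoercivity` of the Type-I/Type-II split of
# `ActionCoercivityEnstrophy` (route QuasipotentialCoercivity; crux-strategist, stmt-NavierStokesRegularity-1443)

Child I (TYPE-I EXCLUSION AT BOUNDED COST): `ActionCoercivityEnstrophy` restricted to admissible
paths all of whose slices obey the Type-I bound `∫_{B(y,r)}|u|² ≤ M r` (scaled local kinetic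
energy, CKN/Seregin `A`), the constant `C` may depend on `M`.

LINE — cut along the two PHASES of an admissible path (three registered stubs, composition
kernel-checked):
* `stub_energy_forced` — ENERGY IS FREE ON THE CONTROLLED PHASE (provable now, M-sized):
  `‖w(T₀)‖₂² ≤ T₀ ∫₀^{T₀}‖g‖₂²` for a classical, uniformly Schwartz forced path from rest
  (`d/dt ½‖w‖² = −ν‖∇w‖² + ⟨g, w⟩ ≤ ‖g‖₂‖w‖₂`, in-tree `IsClassicalNSSolutionOn.hasDerivWithinAt_kineticEnergy`
  shape, then Cauchy–Schwarz in time).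
* `stub_forcedTypeI` — TYPE-I REGULARITY OF THE CONTROLLED PHASE (open): from rest, action `≤ a`,
  horizon `≤ τ`, Type-I bound `M` on every slice ⇒ terminal enstrophy `≤ Z₀(ν, τ, a, M)`.  The
  `L²ₜL²ₓ` forcing is subcritical under the blow-up zoom (`action(u_λ) = λ · action(u)`), so the
  blow-up/compactness + Liouville scheme of the free case governs it; not harder than the free stub.
* `stub_freeTypeI` — QUANTITATIVE TYPE-I EXCLUSION, UNFORCED (open; the hardest stub): a classical
  Leray–Hopf solution on `[0, T₁] ⊂ [0, T₂)` from Schwartz data with enstrophy `≤ Z₀`, energy `≤ E₀`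
  and the Type-I bound `M` on `[0, T₁]`, `T₁ ≤ τ`, has terminal enstrophy `≤ C(ν, τ, M, Z₀, E₀)`.
  Qualitative form = "Type-I blow-up is impossible" (Seregin–Šverák: ⇔ Liouville theorems for
  `M^{2,1}`/`L^{3,∞}`-bounded ancient mild solutions, Koch–Nadirashvili–Seregin–Šverák 2009; known
  in the axisymmetric class); quantitative ⇐ qualitative by Tao-2013-Thm-1.20-type compactness.
* `TypeIActionCoercivity_of : TypeIActionCoercivity` (the child decl BY NAME; A12 shape — no hypotheses, the
  three stubs used inside), real proof: phase bookkeeping, `v 0 = w T₀`,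
  Schwartz decay of the junction slice (`hasRapidSpatialDecay_slice`, proved here; the same lemma
  is in the split assembly `Lines/type_split.lean` / SplitLand.lean), `E₀ = τ a`.

Probes (BC3): each `stub → TypeIActionCoercivity` and `stub → NavierStokesRegularity` FAILS under
`first | exact? | simpa | aesop` (NOTES.md, probe record).
References: G. Seregin, V. Šverák, CPDE 34 (2009) 171–201; G. Koch, N. Nadirashvili, G. Seregin,
V. Šverák, Acta Math. 203 (2009) 83–105 (arXiv:0709.3599); D. Albritton, T. Barker,
arXiv:1811.00502; G. Seregin, J. Math. Sci. 143 (2007); T. Tao, arXiv:1108.1165, Thm 1.20.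
-/

set_option linter.dupNamespace false

noncomputable section

open Literature.Analysis.FluidPDE MeasureTheory Set Function Filter Topology Metric
open scoped ENNReal NNReal Pointwise ContDiff

namespace Summit.NavierStokesRegularity.NavierStokesRegularity.Cruxes.TypeIActionCoercivity.Birth

local notation "ℝ³" => EuclideanSpace ℝ (Fin 3)

/-! ### Slices of a jointly smooth, uniformly Schwartz path -/

section Slice

variable {X : Type*} [NormedAddCommGroup X] [NormedSpace ℝ X]
variable {F : Type*} [NormedAddCommGroup F] [NormedSpace ℝ F]

/-- **Slice derivatives are restrictions of joint derivatives.** For a field jointly smooth on the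
closed slab `[0, T₀] × X` and `t ∈ [0, T₀]`, `‖Dⁿ(w t)(x)‖ ≤ ‖Dⁿ(uncurry w)(t, x)‖` (the joint
derivative taken within the slab): `w t = (uncurry w)(a + ·) ∘ inr` with `a = (t, 0)`, the chain
rule for a continuous linear map on the right (`ContinuousLinearMap.iteratedFDerivWithin_comp_right`)
after a translation (`iteratedFDerivWithin_comp_add_left`), and `‖inr‖ ≤ 1`. [folklore] -/
theorem norm_iteratedFDeriv_slice_le {T₀ : ℝ} (hT₀ : 0 < T₀) {w : ℝ → X → F}
    (h : IsSmoothSpaceTimeOn (Icc 0 T₀) w) {t : ℝ} (ht : t ∈ Icc 0 T₀) (n : ℕ) (x : X) :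
    ‖iteratedFDeriv ℝ n (w t) x‖ ≤
      ‖iteratedFDerivWithin ℝ n (uncurry w) (Icc 0 T₀ ×ˢ univ) (t, x)‖ := by
  set a : ℝ × X := (t, 0) with ha
  set s : Set (ℝ × X) := Icc (-t) (T₀ - t) ×ˢ univ with hs
  -- membership in the translated slab
  have hsT : ∀ z : ℝ × X, z ∈ s ↔ a + z ∈ Icc (0 : ℝ) T₀ ×ˢ (univ : Set X) := by
    rintro ⟨r, y⟩
    simp only [hs, ha, Prod.mk_add_mk, mem_prod, mem_Icc, mem_univ, and_true]
    constructor <;> rintro ⟨h1, h2⟩ <;> constructor <;> linarith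
  have hvadd : a +ᵥ s = Icc (0 : ℝ) T₀ ×ˢ (univ : Set X) := by
    ext z
    rw [mem_vadd_set_iff_neg_vadd_mem, hsT, vadd_eq_add, add_neg_cancel_left]
  have hsU : UniqueDiffOn ℝ s :=
    (uniqueDiffOn_Icc (by linarith [ht.1, ht.2] : -t < T₀ - t)).prod uniqueDiffOn_univ
  have hGs : ContDiffOn ℝ n (fun z : ℝ × X => uncurry w (a + z)) s := by
    have h1 : ContDiffOn ℝ n (uncurry w) (Icc (0 : ℝ) T₀ ×ˢ (univ : Set X)) :=
      h.of_le (by exact_mod_cast le_top)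
    exact h1.comp (contDiff_const.add contDiff_id).contDiffOn fun z hz => (hsT z).1 hz
  have hpre : (ContinuousLinearMap.inr ℝ ℝ X) ⁻¹' s = univ := by
    refine eq_univ_of_forall fun y => ?_
    rw [mem_preimage, hsT]
    simpa [ha] using ht
  have hx : (ContinuousLinearMap.inr ℝ ℝ X) x ∈ s := by
    rw [← mem_preimage, hpre]; exact mem_univ _
  have hpreU : UniqueDiffOn ℝ ((ContinuousLinearMap.inr ℝ ℝ X) ⁻¹' s) := by
    rw [hpre]; exact uniqueDiffOn_univ
  have hcomp := ContinuousLinearMap.iteratedFDerivWithin_comp_right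
    (ContinuousLinearMap.inr ℝ ℝ X) hGs hsU hpreU hx le_rfl
  rw [hpre, iteratedFDerivWithin_univ] at hcomp
  have hslice : ((fun z : ℝ × X => uncurry w (a + z)) ∘ (ContinuousLinearMap.inr ℝ ℝ X)) = w t := by
    funext y
    simp [ha]
  rw [hslice] at hcomp
  have htrans : iteratedFDerivWithin ℝ n (fun z : ℝ × X => uncurry w (a + z)) s
      ((ContinuousLinearMap.inr ℝ ℝ X) x) =
      iteratedFDerivWithin ℝ n (uncurry w) (Icc (0 : ℝ) T₀ ×ˢ (univ : Set X)) (t, x) := by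
    rw [iteratedFDerivWithin_comp_add_left n a, hvadd]
    congr 1
    simp [ha]
  rw [hcomp, htrans]
  refine (ContinuousMultilinearMap.norm_compContinuousLinearMap_le _ _).trans ?_
  exact mul_le_of_le_one_right (norm_nonneg _) (Finset.prod_le_one (fun _ _ => norm_nonneg _)
    fun _ _ => ContinuousLinearMap.norm_inr_le_one ℝ ℝ X)

end Slice

/-- **Slices of a uniformly Schwartz path are Schwartz**: `HasRapidSpatialDecay (w t)` for
`t ∈ [0, T₀]` (from `norm_iteratedFDeriv_slice_le`). [folklore] -/
theorem hasRapidSpatialDecay_slice {T₀ : ℝ} (hT₀ : 0 < T₀) {w : ℝ → ℝ³ → ℝ³}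
    (h : IsSmoothSpaceTimeOn (Icc 0 T₀) w) (hd : HasUniformRapidDecayOn (Icc 0 T₀) w)
    {t : ℝ} (ht : t ∈ Icc 0 T₀) : HasRapidSpatialDecay (w t) := by
  intro n K
  obtain ⟨C, hC⟩ := hd n K
  exact ⟨C, fun x => (mul_le_mul_of_nonneg_left (norm_iteratedFDeriv_slice_le hT₀ h ht n x)
    (by positivity)).trans (hC t ht x)⟩


/-- **Stub 1 (provable now): energy is free on the controlled phase.**
`‖w(T₀)‖₂² ≤ T₀ · ∫₀^{T₀} ‖g‖₂²` for a classical, uniformly Schwartz forced path from rest. [folklore] -/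
theorem stub_energy_forced :
    ∀ ν : ℝ, 0 < ν → ∀ a : NNReal, ∀ (T₀ : ℝ) (w : ℝ → EuclideanSpace ℝ (Fin 3) → EuclideanSpace ℝ (Fin 3)) (q : ℝ → EuclideanSpace ℝ (Fin 3) → ℝ) (g : ℝ → EuclideanSpace ℝ (Fin 3) → EuclideanSpace ℝ (Fin 3)), 0 < T₀ → Literature.Analysis.FluidPDE.IsClassicalNSSolutionOn (Set.Icc 0 T₀) ν g w q → Literature.Analysis.FluidPDE.HasUniformRapidDecayOn (Set.Icc 0 T₀) w → w 0 = 0 → (∫⁻ s in Set.Icc 0 T₀, Literature.Analysis.FluidPDE.eEnergy (g s)) ≤ (a : ENNReal) → Literature.Analysis.FluidPDE.eEnergy (w T₀) ≤ ENNReal.ofReal T₀ * (a : ENNReal) := by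
  sorry

/-- **Stub 2 (open): Type-I regularity of the controlled phase** — terminal enstrophy of a forced
admissible piece from rest under the Type-I bound `M` along the phase is `≤ Z₀(ν, τ, a, M)`.
[conjecture-level stub of the line] -/
theorem stub_forcedTypeI :
    ∀ ν : ℝ, 0 < ν → ∀ τ : ℝ, 0 < τ → ∀ a M : NNReal, ∃ Z₀ : NNReal, ∀ (T₀ : ℝ) (w : ℝ → EuclideanSpace ℝ (Fin 3) → EuclideanSpace ℝ (Fin 3)) (q : ℝ → EuclideanSpace ℝ (Fin 3) → ℝ) (g : ℝ → EuclideanSpace ℝ (Fin 3) → EuclideanSpace ℝ (Fin 3)), 0 < T₀ → T₀ ≤ τ → Literature.Analysis.FluidPDE.IsClassicalNSSolutionOn (Set.Icc 0 T₀) ν g w q → Literature.Analysis.FluidPDE.HasUniformRapidDecayOn (Set.Icc 0 T₀) w → w 0 = 0 → (∫⁻ s in Set.Icc 0 T₀, Literature.Analysis.FluidPDE.eEnergy (g s)) ≤ (a : ENNReal) → (∀ s ∈ Set.Icc 0 T₀, ∀ (y : EuclideanSpace ℝ (Fin 3)) (r : ℝ), 0 < r → (∫⁻ z in Metric.ball y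 r, ‖w s z‖ₑ ^ 2) ≤ (M : ENNReal) * ENNReal.ofReal r) → (∫⁻ y, ENNReal.ofReal (Literature.Analysis.FluidPDE.frobeniusNormSq (fderiv ℝ (w T₀) y))) ≤ (Z₀ : ENNReal) := by
  sorry

/-- **Stub 3 (open; hardest): quantitative Type-I exclusion for unforced classical Leray–Hopf
solutions** (Seregin–Šverák / KNSS Liouville territory). [conjecture-level stub of the line] -/
theorem stub_freeTypeI :
    ∀ ν : ℝ, 0 < ν → ∀ τ : ℝ, 0 < τ → ∀ M Z₀ E₀ : NNReal, ∃ C : NNReal, ∀ (T₁ T₂ : ℝ) (v : ℝ → EuclideanSpace ℝ (Fin 3) → EuclideanSpace ℝ (Fin 3)) (pv : ℝ → EuclideanSpace ℝ (Fin 3) → ℝ), 0 ≤ T₁ → T₁ ≤ τ → T₁ < T₂ → Literature.Analysis.FluidPDE.IsClassicalNSSolutionOn (Set.Ico 0 T₂) ν 0 v pv → Literature.Analysis.FluidPDE.IsLerayHopfOn T₂ ν 0 (v 0) v → Literature.Analysis.FluidPDE.HasRapidSpatialDecay (v 0) → (∫⁻ y, ENNReal.ofReal (Literature.Analysis.FluidPDE.frobeniusNormSq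 (fderiv ℝ (v 0) y))) ≤ (Z₀ : ENNReal) → Literature.Analysis.FluidPDE.eEnergy (v 0) ≤ (E₀ : ENNReal) → (∀ s ∈ Set.Icc 0 T₁, ∀ (y : EuclideanSpace ℝ (Fin 3)) (r : ℝ), 0 < r → (∫⁻ z in Metric.ball y r, ‖v s z‖ₑ ^ 2) ≤ (M : ENNReal) * ENNReal.ofReal r) → (∫⁻ y, ENNReal.ofReal (Literature.Analysis.FluidPDE.frobeniusNormSq (fderiv ℝ (v T₁) y))) ≤ (C : ENNReal) := by
  sorry

/-- **Skeleton theorem (A12 shape, kernel-checked): child I BY NAME from the three stubs** (no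
hypotheses; the registered stubs are used inside; sorries live only in `stub_*`). -/
theorem TypeIActionCoercivity_of :
    Summit.NavierStokesRegularity.NavierStokesRegularity.Theses.QuasipotentialCoercivity.TypeIActionCoercivity := by
  intro ν hν τ hτ a M
  obtain ⟨Z₀, hZ₀⟩ := stub_forcedTypeI ν hν τ hτ a M
  obtain ⟨C, hC⟩ := stub_freeTypeI ν hν τ hτ M Z₀ (Real.toNNReal τ * a)
  refine ⟨C, ?_⟩
  rintro x ⟨T₀, T₁, w, q, g, ⟨hT₀, hsol, hdec, hw0, hact, hIw⟩, hT₁, hsum, T₂, v, pv, hT₁₂, hv, hLH,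
    hv0, hvx, hIv⟩
  have hT₀τ : T₀ ≤ τ := by linarith
  -- phase 1: terminal enstrophy and energy of the controlled phase
  have hZw : (∫⁻ y, ENNReal.ofReal (frobeniusNormSq (fderiv ℝ (w T₀) y))) ≤ (Z₀ : ℝ≥0∞) :=
    hZ₀ T₀ w q g hT₀ hT₀τ hsol hdec hw0 hact hIw
  have hEw : eEnergy (w T₀) ≤ ((Real.toNNReal τ * a : ℝ≥0) : ℝ≥0∞) := by
    refine (stub_energy_forced ν hν a T₀ w q g hT₀ hsol hdec hw0 hact).trans ?_
    rw [ENNReal.coe_mul, ENNReal.ofReal]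
    exact mul_le_mul' (ENNReal.coe_le_coe.2 (Real.toNNReal_le_toNNReal hT₀τ)) le_rfl
  have hdec0 : HasRapidSpatialDecay (w T₀) :=
    hasRapidSpatialDecay_slice hT₀ hsol.smooth_velocity hdec ⟨hT₀.le, le_rfl⟩
  -- phase 2: the free tail starts from `v 0 = w T₀`
  rw [← hv0] at hZw hEw hdec0 hLH
  rw [← hvx]
  exact hC T₁ T₂ v pv hT₁ (by linarith) hT₁₂ hv hLH hdec0 hZw hEw hIv

end Summit.NavierStokesRegularity.NavierStokesRegularity.Cruxes.TypeIActionCoercivity.Birth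

end
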